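import Mathlib
import Literature.MathematicalPhysics.QuantumFieldTheory.Balaban1983to89.T4TwoSpacingDefect
import Literature.MathematicalPhysics.QuantumFieldTheory.King1986.SliceSum

/-!
# T⁴ programme, node NE3 (η-rate of the minimisers) — RESOLVENT TELESCOPING: the stability input (W1)
# of the (115)-currency wall from per-scale OPERATOR bounds

Sixth-generation leaf of the NE3 prover lineage P1 (technique: implicit-function / fixed-point structure of the
one-step constrained variational problem, Bałaban CMP 102 (1985) 277–309 = "B11", Sect. E, read since generation 5
as the DISCRETE implicit-function theorem = STABILITY × CONSISTENCY).  A NEW LEAF: it imports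
`T4TwoSpacingDefect` (v1.1, §7: the wall `ConsistencySized`, `layer_sum_le`, `rowConst_le`,
`ne3Shape_of_consistency(_rpow)`) and the literature seat's `King1986.SliceSum` (`abs_sum_slices_le`) and touches
nothing in either.

## The point (MODEL mathematics: exact algebra and finite sums; the dictionary is stated, never asserted)

Generation 5 typed clause (T2) of the wall, `dl ≤ C_DL·(1 + k log L)` (the DOUBLE-LAYER CONSTANT of the level-k
propagator, `sup_x Σ_{y ∈ faces} |∇_yG_k(x,y)|`), as resting on the UNPRINTED input (W1): a POINTWISE sub-unit profile
`|∇_yG_k(x,y)| ≤ C|x − y|^{1−d}`, `1 ≤ |x − y| ≤ L^k`.  The series prints cube-localised OPERATOR bounds (B9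
(3.42)–(3.47), CMP 89 (1.9)–(1.10)); used DIRECTLY on a thin layer they are blind to its thinness (generation-5 census).
The observation of this leaf: the pointwise profile is a few lines of algebra away from OPERATOR bounds, provided one
has them AT EVERY INTERMEDIATE SCALE `j ≤ k` — which is the form in which they are printed.
 (1) RESOLVENT TELESCOPING.  Let `K_j` be the full level-j inverse propagator on the SAME fine lattice (covariant
     Laplacian + level-j averaging mass `a·L^{−2j}Q_j*Q_j` [+ the level-j gauge-fixing term]), `G⁽ʲ⁾ := K_j⁻¹`,
     `G⁽ᵏ⁾ = G_k` the object of (T2).  Then `G⁽ʲ⁺¹⁾ − G⁽ʲ⁾ = G⁽ʲ⁾(K_j − K_{j+1})G⁽ʲ⁺¹⁾` (`resolvent_sub`) and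
     `G_k·D = G⁽⁰⁾D + Σ_{j<k} G⁽ʲ⁾(K_j − K_{j+1})(G⁽ʲ⁺¹⁾D)` for any fixed `D` (a lattice difference in the second
     variable, say) (`resolvent_telescope(_mul)`, `sum_sliceKernel`).  The auxiliary `G⁽ʲ⁾`, `j < k`, are free: only
     `G⁽ᵏ⁾` is prescribed.
 (2) SANDWICH.  An exponentially weighted ROW bound of `A = G⁽ʲ⁾` (`α`), a weighted POINTWISE bound of
     `P = K_j − K_{j+1}` (`π₀`) and a weighted COLUMN bound of `B = G⁽ʲ⁺¹⁾D` (`β`) at one scale `s` give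
     `|(A·P·B)(x,y)| ≤ α·β·π₀·e^{−δρ(x,y)/s}` (`sandwich_pointwise`).  The block projection supplies the POINTWISE factor:
     `α ≲ s²`, `β ≲ s`, `π₀ ≲ s^{−(d+2)}` ⇒ the slice has King's (3.63) SHAPE `C·(L^{j+1})^{1−d}e^{−δρ/L^{j+1}}`
     (`slice_const_le`, `slice_bound_of_operatorData`); a cube-localised operator bound of the printed form yields the
     weighted row bound by block counting (`weightedRow_of_localised`).
 (3) `King1986.abs_sum_slices_le` (η := 1 lattice unit, `p = d − 1`, `k + 1` slices) ⇒ `|(G_kD)(x,y)| ≤ C·K_δ/ρ^{d−1}`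
     for `ρ ≥ 1` (`profile_of_slices`); the per-slice bounds also give the core `|(G_kD)(x,x)| ≤ 2C` (`core_of_slices`)
     — no separate bounded-kernel input is needed.
 (4) `layer_sum_le` + `rowConst_le` ⇒ (T2) with `C_DL = 2C + A·C·K_δ·(1 + log ℓ)`, UNIFORM IN `k` exactly when
     `C, δ, A` are (`doubleLayerRow_le`, `consistencyT2_of_slices`), hence `ConsistencySized` (`consistencySized_of_slices`)
     and the node's shape `T4EtaRateMin.NE3Shape` BY NAME (`ne3Shape_of_slices(_rpow)`).
So (W1) leaves the list of unprinted POINTWISE inputs.  What replaces it are hypothesis SHAPES of printed TYPE, per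
level `k` and slice `j ≤ k`, with constants uniform in `j, k`:
 (A_j)/(B_j) weighted row / column bounds of `G⁽ʲ⁾`, `G⁽ʲ⁺¹⁾D` at scale `L^{j+1}` — printed TYPE at each scale:
     B9 Thms 3.1 / 3.3 (covariant; constants «dependent on d and L only» which «do not depend on the sequence {Ω_j}»),
     READ for the domain sequence that stops at level `j` [reading (I′): the level-k regularity class (3.35) is
     contained in the level-j one, `(L^jη)^{−1} ≥ (L^kη)^{−1}`]; flat / weak abelian: CMP 89 p. 573 (1.9)–(1.10),
     constants «independent of A, k, Ω»; King p. 663 («Proposition 3.7 follows immediately from Theorem 3.3 and the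
     scaling properties of the operators») is the printed precedent of exactly this step, for the RG-generated
     decomposition (2.17) instead of the resolvent one;
 (P_j) weighted pointwise bound of `K_j − K_{j+1}`: for the averaging-mass part this is the DEFINITION of block
     averaging [model] (kernel `a(L^j)^{−d−2}·𝟙[same j-block]` in lattice units; parallel transporters are unitary for
     B7's covariant averages); for the gauge-fixing part printed TYPE B9 (3.49), whose `DPD*` item carries the
     prefactor `(L^jη)^{−(d+2)}` in print (display below, read on the render by XREAD C-t4lit2g6-1) [reading (I″),
     narrowed in v1.1: B9's weighted distance `d(y,y′)` on `Λ_j`-cubes ↔ `ρ/L^j`, decay rate `δ₀/2`, and the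
     two-sequence difference bounded by the sum of the two (3.49) bounds];
 geometry [model]: the unit-face skeleton has `≤ A·r^{d−2}` sites on the sup-shell of radius `r` about any point,
     `A` depending on `d` and the torus side `ℓ` in unit blocks.
NOTHING is asserted about Bałaban's objects: every statement below is over abstract rings / matrices / kernels, the
hypotheses are SHAPES, and `ConsistencySized` is REACHED, never consumed as a fact.  The clauses (T3)/(T4) (the
CONSISTENCY input (W2): face-transmission structure of `U_{k+1}(V)`) are untouched by this leaf and enter as
hypotheses `h3`, `h4`.

v1.1 (DOCFIX, docstring-only; every declaration byte-identical to v1 = p187668, sha256[:16] 9ed199182c4616b3):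
the cross-read XREAD C-t4lit2g6-1 (certificate `t4/b2b-balaban-t4-lit2/g6/xread1/XREAD-T4SliceTelescoping-v1.md`,
renders read as images) found the quotations below consistent and asked for two glyph-level corrections inside the
guillemets (D-1: (3.35) «|∇^ηA|», «T_{L^{−j}}»; D-2: CMP 89 p. 573 «for e sufficiently small», the (1.10) items as
printed) and supplied the (3.42)/(3.49) displays (I-1/I-2), folded here; reading (I″) is narrowed accordingly.

## What is printed and located ([R] = quoted from the materialised OCR text of the held paper, `lit read <key>`,
## page file in brackets; «…» spans re-read on the journal-page renders by XREAD C-t4lit2g6-1)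

* [R] B9 = Bałaban, *Propagators for lattice gauge theories in a background field*, CMP 99 (1985) 389–434
  (`paper:balaban1985-cmp99-background-propagators`).  p. 397 [p0009]: «Theorem 3.1. There exist positive constants
  M₁, δ₀, a₀, B₀ dependent on d and L only, a constant B₀(β) dependent on d, L and β, 0 ≤ β < 1 (B₀(β) → ∞ if
  β → 1), such that for M ≥ M₁ and for an arbitrary configuration U satisfying the regularity condition (3.35) with
  Mα₀ ≤ a₀, the operator G′(U) (a = 1) satisfies the inequalities» (3.42)–(3.47) [(3.42), display as read on the
  render by the XREAD: sup bounds of the FOUR items `|(G′(U)λ)(x)|, |(∇_UG′(U)λ)(x)|, |(G′(U)∇*_Uλ)(x)|,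
  |(Δ_UG′(U)λ)(x)|` by `B₀[(L^jη)², L^jη, L^jη, 1]e^{−δ₀d(y,y′)}|λ|` for `x ∈ Δ(y)`, `y ∈ Λ_j`, `supp λ ⊂ Δ(y′)`;
  SHAPE only].  p. 399 [p0011]: «Let us stress
  that the constants in the formulations of both theorems do not depend on the sequence {Ω_j}, j = 0, 1,…,k, if the
  conditions (2.1), (2.2) are satisfied.» and «Theorem 3.3. Under the assumptions of Theorem 3.1, and with the constants
  described there, the operator G(U) (a = 1) satisfies the inequalities (3.42)–(3.47), with G′(U) replaced by G(U) and
  λ replaced by a function J defined at bonds of the lattice T_η or Ω₀, and with values in g.» [print: «of the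
  lattice T_η, or Ω₀, and»]; ibid. (3.49) [display as read on the render by the XREAD, item (d)]: `[|P(x,x′)|,
  |(DP)_μ(x,x′)|, |(PD*)_ν(x,x′)|, |(DPD*)_{μν}(x,x′)|] ≤ O(1)[1, (L^jη)^{−1}, (L^jη)^{−1}, (L^jη)^{−2}](L^{j′}η)^{−d}
  e^{−(1/2)δ₀d(y,y′)}` for `x ∈ Δ(y)`, `y ∈ Λ_j`, `x′ ∈ Δ(y′)`, `y′ ∈ Λ_{j′}`, followed by «We have also the
  corresponding bounds for Hölder norms of the kernel (DPD*)_{μν}(x, x′).» — so the `DPD*` item at `j′ = j` carries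
  the prefactor `(L^jη)^{−(d+2)}` of reading (I″) IN PRINT, with decay rate `δ₀/2` in B9's weighted distance `d(y,y′)`
  («defined by (2.36) in [4]», p. 397); what remains of reading (I″): (i) `d(y,y′)` restricted to `Λ_j`-cubes ↔
  `ρ/L^j` of this file, (ii) `K_j − K_{j+1}` involves the projections of TWO sequences (stopping at `j` and at
  `j+1`) and (3.49) bounds each, the difference by the SUM (no cancellation is needed for the size `π₀`).
  p. 396 [p0008], (3.35): «|A| < O(1)Mα₀(L^jη)^{−1}, |∇^ηA| < O(1)Mα₀(L^jη)^{−2} on □, where O(1)M is a size of □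
  in T_{L^{−j}}» ⟦T_{L^{−j}} = the lattice of big blocks, i.e. the size of □ in T_η is O(1)ML^jη, as the print says
  six lines above⟧ — the regularity class is scale-indexed.
* [R] Bałaban, *Regularity and decay of lattice Green's functions*, CMP 89 (1983) 571–597
  (`paper:balaban1983-cmp89-regularity-decay`), p. 573 [p0003]: «Theorem (Proposition 2.1 of [1]). For α < 1 there exist
  positive constants δ₀, c₀, R₀ independent of A, k, Ω and depending on d, M only, c₀ on α also, such that for e
  sufficiently small and for an arbitrary function f: Ω → R^N, we have … (1.9) … Similarly |(D^η_{A,μ}G_k(Ω, A)f)(x)|,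
  |(G_k(Ω, A)(x)| ≤ c₀exp(−δ₀dist(x, supp f))‖f‖_∞ (1.10) for x ∈ Ω, dist(x, Ω^c) ≥ R₀.» ⟦so printed: `e` is the
  charge, as in the (1.8) sentence; the second item of (1.10) lacks its `f` in print⟧ and «For some simple sets Ω,
  e.g. for rectangular parallelepipeds, the inequalities hold without any restrictions on the points x, x′».
* [R] C. King, CMP 102 (1986) 649–677, p. 653 (2.17) (the telescoping decomposition of `G_k` over scales) and p. 663
  Prop. 3.7 (3.63) (per-slice pointwise bounds `C{(L^jη)^{2−d}, (L^jη)^{1−d}}·exp[−δ₀(L^jη)^{−1}|x − y|]`) — quoted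
  verbatim in the header of `King1986.SliceSum`, whose `abs_sum_slices_le` is consumed here BY NAME.

Honest framing: finite-T⁴ ultraviolet bookkeeping about MINIMISERS (rung (B)+1 of the cell's ladder); no conditional
(`BetaPertH`, (B), (B^μ)) enters; nothing here bears on infinite volume, a mass gap, or the Clay problem.  No `sorry`,
no axioms beyond Mathlib's; ring identities and finite-sum estimates are [folklore]; every [model] / reading sentence
is dictionary, never a hypothesis discharged by citation.  Records: `t4/T4-EST-U1b-OSC.md` v1.8 (RESULT 13), GAPS
G-ne3p1-19 ff., XREAD C-t4lit2g6-1 (GAPS l.7257) of the cell `pub-balaban`.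
-/

noncomputable section

open Finset Real

namespace Literature.MathematicalPhysics.QuantumFieldTheory.Balaban1983to89.T4SliceTelescoping

open Literature.MathematicalPhysics.QuantumFieldTheory.Balaban1983to89.T4TwoSpacingDefect
  (layer_sum_le rowConst_le ConsistencySized ne3Shape_of_consistency ne3Shape_of_consistency_rpow)
open Literature.MathematicalPhysics.QuantumFieldTheory.Balaban1983to89.T4EtaRateMin (Readings NE3Shape)
open Literature.MathematicalPhysics.QuantumFieldTheory.Balaban1983to89.T4FixedPointResponse (OneStepCorrectionRate)
open Literature.MathematicalPhysics.QuantumFieldTheory.King1986 (abs_sum_slices_le)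

/-! ## §1  Resolvent telescoping (ring identities) -/
section Resolvent

variable {R : Type*} [Ring R]

/-- **Resolvent identity.**  If `G` is a left inverse of `K` and `G′` a right inverse of `K′`, then
`G′ − G = G·(K − K′)·G′`.  [folklore]  Dictionary: `K = K_j`, `K′ = K_{j+1}` the level-j / level-(j+1) inverse
propagators on the same lattice; `K − K′` is the difference of the averaging masses (and gauge-fixing terms). -/
theorem resolvent_sub {K K' G G' : R} (hG : G * K = 1) (hG' : K' * G' = 1) :
    G' - G = G * (K - K') * G' := by
  have h : G * (K - K') * G' = G * K * G' - G * (K' * G') := by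
    simp only [mul_sub, sub_mul, mul_assoc]
  rw [h, hG, hG', one_mul, mul_one]

/-- **Telescoping over the scales.**  For a family of two-sided inverses `G j = (K j)⁻¹`,
`G k = G 0 + Σ_{j<k} G j·(K j − K (j+1))·G (j+1)`.  [folklore]  (King's (2.17), p. 653, is the RG-generated relative;
this is the resolvent version, which needs no unit-lattice covariances.) -/
theorem resolvent_telescope (K G : ℕ → R) (hl : ∀ j, G j * K j = 1) (hr : ∀ j, K j * G j = 1) (k : ℕ) :
    G k = G 0 + ∑ j ∈ Finset.range k, G j * (K j - K (j + 1)) * G (j + 1) := by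
  induction k with
  | zero => simp
  | succ k ih =>
      rw [Finset.sum_range_succ, ← add_assoc, ← ih, ← resolvent_sub (hl k) (hr (k + 1))]
      abel

/-- The telescoping identity right-multiplied by a fixed element `D` (a lattice difference in the second variable:
the GRADIENT kernel `∇_yG_k(x,y)` of clause (T2) is an entry of `G_k·D`). [folklore] -/
theorem resolvent_telescope_mul (K G : ℕ → R) (hl : ∀ j, G j * K j = 1) (hr : ∀ j, K j * G j = 1)
    (k : ℕ) (D : R) :
    G k * D = G 0 * D + ∑ j ∈ Finset.range k, G j * (K j - K (j + 1)) * (G (j + 1) * D) := by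
  rw [resolvent_telescope K G hl hr k, add_mul, Finset.sum_mul]
  simp only [mul_assoc]

end Resolvent

/-! ## §2  Slices as kernels; the sandwich lemma -/
section Slices

variable {X : Type*} [Fintype X]

/-- The SLICE KERNELS of the telescoped family, right-multiplied by `D`: slice `0` is `G⁽⁰⁾D` (the unit-massive
lattice-scale piece), slice `j + 1` is `G⁽ʲ⁾(K_j − K_{j+1})(G⁽ʲ⁺¹⁾D)`.  A definition over abstract matrices — the
dictionary to Bałaban's propagators is [model], never asserted. [folklore] -/
def sliceKernel (G K : ℕ → Matrix X X ℝ) (D : Matrix X X ℝ) : ℕ → X → X → ℝ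
  | 0 => fun x y => (G 0 * D) x y
  | j + 1 => fun x y => (G j * (K j - K (j + 1)) * (G (j + 1) * D)) x y

/-- The `k + 1` slice kernels sum to the entry of `G_k·D`. [folklore] -/
theorem sum_sliceKernel [DecidableEq X] (G K : ℕ → Matrix X X ℝ) (D : Matrix X X ℝ) (hl : ∀ j, G j * K j = 1)
    (hr : ∀ j, K j * G j = 1) (k : ℕ) (x y : X) :
    ∑ i ∈ Finset.range (k + 1), sliceKernel G K D i x y = (G k * D) x y := by
  rw [Finset.sum_range_succ', resolvent_telescope_mul K G hl hr k D, Matrix.add_apply, Matrix.sum_apply]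
  simp only [sliceKernel]
  exact add_comm _ _

/-- **The sandwich lemma (one slice, pointwise, from OPERATOR data).**  `ρ` a pseudo-distance with the three-point
triangle inequality; `A` with exponentially weighted ROW sums `≤ α` at scale `s`, `B` with weighted COLUMN sums `≤ β`,
`P` with the weighted POINTWISE bound `|P z w|·e^{δρ(z,w)/s} ≤ π₀` (a block projection: strictly local, pointwise
small; or an exponentially localised kernel).  Then `|(A·P·B)(x,y)| ≤ α·β·π₀·e^{−δρ(x,y)/s}`. [folklore] -/
theorem sandwich_pointwise (A P B : Matrix X X ℝ) (ρ : X → X → ℝ) {δ s α β π₀ : ℝ} (hs : 0 < s)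
    (hδ : 0 ≤ δ) (htri : ∀ x z w y, ρ x y ≤ ρ x z + ρ z w + ρ w y)
    (hA : ∀ x, ∑ z, |A x z| * Real.exp (δ * (ρ x z / s)) ≤ α)
    (hP : ∀ z w, |P z w| * Real.exp (δ * (ρ z w / s)) ≤ π₀)
    (hB : ∀ y, ∑ w, |B w y| * Real.exp (δ * (ρ w y / s)) ≤ β) (x y : X) :
    |(A * P * B) x y| ≤ α * β * π₀ * Real.exp (-(δ * (ρ x y / s))) := by
  set E : X → X → ℝ := fun u v => Real.exp (δ * (ρ u v / s)) with hE
  have hEpos : ∀ u v, 0 < E u v := fun u v => Real.exp_pos _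
  have hπ : 0 ≤ π₀ := le_trans (mul_nonneg (abs_nonneg _) (hEpos x x).le) (hP x x)
  have hβn : 0 ≤ ∑ w, |B w y| * E w y :=
    Finset.sum_nonneg fun w _ => mul_nonneg (abs_nonneg _) (hEpos w y).le
  have hαn : 0 ≤ ∑ z, |A x z| * E x z :=
    Finset.sum_nonneg fun z _ => mul_nonneg (abs_nonneg _) (hEpos x z).le
  have hβ0 : 0 ≤ β := le_trans hβn (hB y)
  set c : ℝ := Real.exp (-(δ * (ρ x y / s))) with hc
  have hcpos : 0 < c := Real.exp_pos _
  -- termwise bound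
  have hterm : ∀ z w, |A x z * P z w * B w y|
      ≤ c * ((|A x z| * E x z) * ((|P z w| * E z w) * (|B w y| * E w y))) := by
    intro z w
    have hone : 1 ≤ c * (E x z * (E z w * E w y)) := by
      have h3 := htri x z w y
      have hdiv0 : ρ x y / s ≤ ρ x z / s + ρ z w / s + ρ w y / s := by
        rw [← add_div, ← add_div]
        exact div_le_div_of_nonneg_right h3 hs.le
      have hdiv : δ * (ρ x y / s) ≤ δ * (ρ x z / s) + δ * (ρ z w / s) + δ * (ρ w y / s) := by
        have h := mul_le_mul_of_nonneg_left hdiv0 hδ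
        rw [mul_add, mul_add] at h
        exact h
      simp only [hc, hE]
      rw [← Real.exp_add, ← Real.exp_add, ← Real.exp_add]
      exact Real.one_le_exp (by linarith)
    have hnn : 0 ≤ |A x z| * |P z w| * |B w y| := by positivity
    calc |A x z * P z w * B w y| = |A x z| * |P z w| * |B w y| * 1 := by rw [abs_mul, abs_mul, mul_one]
      _ ≤ |A x z| * |P z w| * |B w y| * (c * (E x z * (E z w * E w y))) :=
          mul_le_mul_of_nonneg_left hone hnn
      _ = c * ((|A x z| * E x z) * ((|P z w| * E z w) * (|B w y| * E w y))) := by ring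
  -- expand the triple product
  have hexp : (A * P * B) x y = ∑ w, ∑ z, A x z * P z w * B w y := by
    simp only [Matrix.mul_apply, Finset.sum_mul]
  rw [hexp]
  calc |∑ w, ∑ z, A x z * P z w * B w y|
      ≤ ∑ w, ∑ z, |A x z * P z w * B w y| :=
        (Finset.abs_sum_le_sum_abs _ _).trans (Finset.sum_le_sum fun w _ => Finset.abs_sum_le_sum_abs _ _)
    _ ≤ ∑ w, ∑ z, c * ((|A x z| * E x z) * (π₀ * (|B w y| * E w y))) := by
        refine Finset.sum_le_sum fun w _ => Finset.sum_le_sum fun z _ => (hterm z w).trans ?_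
        refine mul_le_mul_of_nonneg_left ?_ hcpos.le
        refine mul_le_mul_of_nonneg_left ?_ (mul_nonneg (abs_nonneg _) (hEpos x z).le)
        exact mul_le_mul_of_nonneg_right (hP z w) (mul_nonneg (abs_nonneg _) (hEpos w y).le)
    _ = ∑ w, (c * π₀ * (|B w y| * E w y)) * (∑ z, |A x z| * E x z) := by
        refine Finset.sum_congr rfl fun w _ => ?_
        rw [Finset.mul_sum]
        exact Finset.sum_congr rfl fun z _ => by ring
    _ = c * π₀ * (∑ w, |B w y| * E w y) * (∑ z, |A x z| * E x z) := by
        rw [← Finset.sum_mul, ← Finset.mul_sum]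
    _ ≤ c * π₀ * β * α := by
        have h1 : c * π₀ * (∑ w, |B w y| * E w y) ≤ c * π₀ * β :=
          mul_le_mul_of_nonneg_left (hB y) (mul_nonneg hcpos.le hπ)
        exact mul_le_mul h1 (hA x) hαn (mul_nonneg (mul_nonneg hcpos.le hπ) hβ0)
    _ = α * β * π₀ * c := by ring

/-- **Weighted row bound from a cube-localised operator bound (block counting).**  If the row `a z = |A x z|`
(fixed `x`) satisfies, block by block, `Σ_{z ∈ b} a z ≤ α₀·e^{−δ₀·Dist(b)/s}` (the printed form: a sup bound for
inputs supported in one cube, CMP 89 (1.10) / B9 (3.42), in lattice units at scale `s`), if `ρ z ≤ Dist(blk z) + c·s`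
(a point is no farther than its block plus a block diameter) and `Σ_b e^{−(δ₀−δ)Dist(b)/s} ≤ K` (geometric block
count), then `Σ_z a z·e^{δρ z/s} ≤ α₀·e^{δc}·K`. [folklore] -/
theorem weightedRow_of_localised {Y B : Type*} [Fintype Y] [Fintype B] [DecidableEq B]
    (blk : Y → B) (a : Y → ℝ) (ρ : Y → ℝ) (Dist : B → ℝ) {δ₀ δ s c α₀ K : ℝ} (hs : 0 < s)
    (hδ : 0 ≤ δ) (ha : ∀ z, 0 ≤ a z)
    (hloc : ∀ b, ∑ z ∈ Finset.univ.filter (fun z => blk z = b), a z ≤ α₀ * Real.exp (-(δ₀ * (Dist b / s))))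
    (hρ : ∀ z, ρ z ≤ Dist (blk z) + c * s)
    (hK : ∑ b, Real.exp (-((δ₀ - δ) * (Dist b / s))) ≤ K) (hα₀ : 0 ≤ α₀) :
    ∑ z, a z * Real.exp (δ * (ρ z / s)) ≤ α₀ * Real.exp (δ * c) * K := by
  have hmaps : ∀ z ∈ (Finset.univ : Finset Y), blk z ∈ (Finset.univ : Finset B) := fun z _ => Finset.mem_univ _
  rw [← Finset.sum_fiberwise_of_maps_to hmaps]
  calc ∑ b, ∑ z ∈ Finset.univ.filter (fun z => blk z = b), a z * Real.exp (δ * (ρ z / s))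
      ≤ ∑ b, ∑ z ∈ Finset.univ.filter (fun z => blk z = b),
          a z * (Real.exp (δ * (Dist b / s)) * Real.exp (δ * c)) := by
        refine Finset.sum_le_sum fun b _ => Finset.sum_le_sum fun z hz => ?_
        have hzb : blk z = b := (Finset.mem_filter.1 hz).2
        refine mul_le_mul_of_nonneg_left ?_ (ha z)
        rw [← Real.exp_add]
        refine Real.exp_le_exp.2 ?_
        have h0 := hρ z
        rw [hzb] at h0
        have h1 : ρ z / s ≤ Dist b / s + c := by
          have h2 := div_le_div_of_nonneg_right h0 hs.le
          have h3 : (Dist b + c * s) / s = Dist b / s + c := by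
            rw [add_div, mul_div_assoc, div_self hs.ne', mul_one]
          linarith [h2, h3]
        have h4 := mul_le_mul_of_nonneg_left h1 hδ
        rw [mul_add] at h4
        exact h4
    _ = ∑ b, (Real.exp (δ * (Dist b / s)) * Real.exp (δ * c)) *
          ∑ z ∈ Finset.univ.filter (fun z => blk z = b), a z := by
        refine Finset.sum_congr rfl fun b _ => ?_
        rw [Finset.mul_sum]
        exact Finset.sum_congr rfl fun z _ => by ring
    _ ≤ ∑ b, (Real.exp (δ * (Dist b / s)) * Real.exp (δ * c)) * (α₀ * Real.exp (-(δ₀ * (Dist b / s)))) := by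
        refine Finset.sum_le_sum fun b _ => ?_
        exact mul_le_mul_of_nonneg_left (hloc b) (by positivity)
    _ = α₀ * Real.exp (δ * c) * ∑ b, Real.exp (-((δ₀ - δ) * (Dist b / s))) := by
        rw [Finset.mul_sum]
        refine Finset.sum_congr rfl fun b _ => ?_
        have h : Real.exp (-((δ₀ - δ) * (Dist b / s)))
            = Real.exp (δ * (Dist b / s)) * Real.exp (-(δ₀ * (Dist b / s))) := by
          rw [← Real.exp_add]
          congr 1
          ring
        rw [h]
        ring
    _ ≤ α₀ * Real.exp (δ * c) * K := mul_le_mul_of_nonneg_left hK (by positivity)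

/-- **Scale bookkeeping of one slice.**  Row constant `α ≤ C_A·s²` (a propagator in lattice units at scale `s`),
column constant of the gradient factor `β ≤ C_B·s`, pointwise constant of the block projection `π₀ ≤ C_P/s^{d+2}`
(`a·s^{−2}` times the averaging kernel `s^{−d}`) ⇒ `α·β·π₀ ≤ C_A·C_B·C_P / s^{d−1}` — the exponent `1 − d` of King's
(3.63) gradient clause. [folklore] -/
theorem slice_const_le {CA CB CP s α β π₀ : ℝ} {d : ℕ} (hd : 1 ≤ d) (hs : 0 < s) (hCA : 0 ≤ CA)
    (hCB : 0 ≤ CB) (hβ0 : 0 ≤ β) (hπ0 : 0 ≤ π₀)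
    (hα : α ≤ CA * s ^ 2) (hβ : β ≤ CB * s) (hπ : π₀ ≤ CP / s ^ (d + 2)) :
    α * β * π₀ ≤ CA * CB * CP / s ^ (d - 1) := by
  have hs0 : s ≠ 0 := hs.ne'
  have hCAs : 0 ≤ CA * s ^ 2 := mul_nonneg hCA (pow_nonneg hs.le 2)
  have h1 : α * β ≤ (CA * s ^ 2) * (CB * s) := mul_le_mul hα hβ hβ0 hCAs
  have h2 : α * β * π₀ ≤ (CA * s ^ 2) * (CB * s) * (CP / s ^ (d + 2)) :=
    mul_le_mul h1 hπ hπ0 (mul_nonneg hCAs (mul_nonneg hCB hs.le))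
  have hsd : s ^ (d + 2) = s ^ 3 * s ^ (d - 1) := by
    rw [← pow_add]
    congr 1
    omega
  calc α * β * π₀ ≤ (CA * s ^ 2) * (CB * s) * (CP / s ^ (d + 2)) := h2
    _ = CA * CB * CP / s ^ (d - 1) := by
        rw [hsd]
        field_simp

/-- **One slice in King's (3.63) shape from operator data at scale `L^{j+1}`** (`sandwich_pointwise` +
`slice_const_le`).  [folklore]  Dictionary (hypothesis SHAPES, printed TYPE per scale — B9 Thms 3.1/3.3, CMP 89
(1.10); [model] for the block projection): `A = G⁽ʲ⁾`, `P = K_j − K_{j+1}`, `B = G⁽ʲ⁺¹⁾D`. -/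
theorem slice_bound_of_operatorData (A P B : Matrix X X ℝ) (ρ : X → X → ℝ)
    {δ L CA CB CP α β π₀ : ℝ} {d : ℕ} (j : ℕ) (hd : 1 ≤ d) (hL : 0 < L) (hδ : 0 ≤ δ) (hCA : 0 ≤ CA)
    (hCB : 0 ≤ CB) (htri : ∀ x z w y, ρ x y ≤ ρ x z + ρ z w + ρ w y)
    (hA : ∀ x, ∑ z, |A x z| * Real.exp (δ * (ρ x z / L ^ (j + 1))) ≤ α)
    (hP : ∀ z w, |P z w| * Real.exp (δ * (ρ z w / L ^ (j + 1))) ≤ π₀)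
    (hB : ∀ y, ∑ w, |B w y| * Real.exp (δ * (ρ w y / L ^ (j + 1))) ≤ β)
    (hα : α ≤ CA * (L ^ (j + 1)) ^ 2) (hβ : β ≤ CB * L ^ (j + 1)) (hπ : π₀ ≤ CP / (L ^ (j + 1)) ^ (d + 2)) :
    ∀ x y, |(A * P * B) x y|
      ≤ CA * CB * CP * (Real.exp (-(δ * (ρ x y / L ^ (j + 1)))) / (L ^ (j + 1)) ^ (d - 1)) := by
  intro x y
  have hs : 0 < L ^ (j + 1) := pow_pos hL _
  have h := sandwich_pointwise A P B ρ hs hδ htri hA hP hB x y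
  have hE : ∀ u v, 0 < Real.exp (δ * (ρ u v / L ^ (j + 1))) := fun u v => Real.exp_pos _
  have hπ0 : 0 ≤ π₀ := le_trans (mul_nonneg (abs_nonneg _) (hE x x).le) (hP x x)
  have hβ0 : 0 ≤ β :=
    le_trans (Finset.sum_nonneg fun w _ => mul_nonneg (abs_nonneg _) (hE w y).le) (hB y)
  have hc := slice_const_le hd hs hCA hCB hβ0 hπ0 hα hβ hπ
  calc |(A * P * B) x y| ≤ α * β * π₀ * Real.exp (-(δ * (ρ x y / L ^ (j + 1)))) := h
    _ ≤ CA * CB * CP / (L ^ (j + 1)) ^ (d - 1) * Real.exp (-(δ * (ρ x y / L ^ (j + 1)))) :=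
        mul_le_mul_of_nonneg_right hc (Real.exp_pos _).le
    _ = CA * CB * CP * (Real.exp (-(δ * (ρ x y / L ^ (j + 1)))) / (L ^ (j + 1)) ^ (d - 1)) := by ring

end Slices

/-! ## §3  From per-slice bounds to the profile, the core, the double layer, and clause (T2) -/
section Profile

/-- King's summation constant `K_δ,p = 2·(p+1)!/δ^{p+1} + 2` of `King1986.sliceSum_le`. [folklore] -/
def sliceConst (δ : ℝ) (p : ℕ) : ℝ := 2 * (p + 1).factorial / δ ^ (p + 1) + 2

/-- `K_δ,p ≥ 0` for `δ > 0`. [folklore] -/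
theorem sliceConst_nonneg {δ : ℝ} (hδ : 0 < δ) (p : ℕ) : 0 ≤ sliceConst δ p := by
  unfold sliceConst
  positivity

/-- Sanity: `K_{1,1} = 2·2!/1 + 2 = 6`. -/
example : sliceConst 1 1 = 6 := by
  norm_num [sliceConst, Nat.factorial]

/-- **Profile from slices** (`King1986.abs_sum_slices_le` with `η := 1` lattice unit): per-slice bounds of the (3.63)
shape at scales `L^i`, `i < n`, give `|Σ_{i<n} g i x y| ≤ C·K_δ,p/ρ(x,y)^p` for `ρ(x,y) ≥ 1`. [folklore] -/
theorem profile_of_slices {X : Type*} (g : ℕ → X → X → ℝ) (ρ : X → X → ℝ) {L δ C : ℝ} {p : ℕ} (n : ℕ)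
    (hL : 2 ≤ L) (hδ : 0 < δ) (hC : 0 ≤ C) (hp : 1 ≤ p)
    (hg : ∀ i < n, ∀ x y, |g i x y| ≤ C * (Real.exp (-(δ * (ρ x y / L ^ i))) / (L ^ i) ^ p))
    (x y : X) (hxy : 1 ≤ ρ x y) :
    |∑ i ∈ Finset.range n, g i x y| ≤ C * sliceConst δ p / ρ x y ^ p := by
  have h := abs_sum_slices_le g ρ L 1 δ C p n hL one_pos hδ hC hp (by simpa using hg) x y (by simpa using hxy)
  simpa [sliceConst, mul_div_assoc] using h

/-- **Core from slices**: with no lower bound on `ρ` (in particular at `y = x`) the per-slice bounds give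
`|Σ_{i<n} g i x y| ≤ 2C` (drop the exponential, geometric series with ratio `L^{−p} ≤ 1/2`). [folklore] -/
theorem core_of_slices {X : Type*} (g : ℕ → X → X → ℝ) (ρ : X → X → ℝ) {L δ C : ℝ} {p : ℕ} (n : ℕ)
    (hL : 2 ≤ L) (hδ : 0 ≤ δ) (hC : 0 ≤ C) (hp : 1 ≤ p) (hρ : ∀ x y, 0 ≤ ρ x y)
    (hg : ∀ i < n, ∀ x y, |g i x y| ≤ C * (Real.exp (-(δ * (ρ x y / L ^ i))) / (L ^ i) ^ p))
    (x y : X) :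
    |∑ i ∈ Finset.range n, g i x y| ≤ 2 * C := by
  have hL0 : 0 < L := by linarith
  have hL1 : 1 ≤ L := by linarith
  have hterm : ∀ i < n, |g i x y| ≤ C * (1 / 2) ^ i := by
    intro i hi
    refine (hg i hi x y).trans (mul_le_mul_of_nonneg_left ?_ hC)
    have hLi : 1 ≤ L ^ i := one_le_pow₀ hL1
    have hLi0 : 0 < L ^ i := pow_pos hL0 i
    have hexp : Real.exp (-(δ * (ρ x y / L ^ i))) ≤ 1 := by
      rw [Real.exp_le_one_iff]
      have : 0 ≤ δ * (ρ x y / L ^ i) := mul_nonneg hδ (div_nonneg (hρ x y) hLi0.le)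
      linarith
    have h1 : Real.exp (-(δ * (ρ x y / L ^ i))) / (L ^ i) ^ p ≤ 1 / (L ^ i) ^ p :=
      div_le_div_of_nonneg_right hexp (pow_nonneg hLi0.le p)
    have h2 : 1 / (L ^ i) ^ p ≤ 1 / (L ^ i) ^ 1 :=
      one_div_le_one_div_of_le (pow_pos hLi0 1) (pow_le_pow_right₀ hLi hp)
    have h3 : 1 / (L ^ i) ^ 1 ≤ (1 / 2) ^ i := by
      rw [pow_one, one_div, ← inv_pow, one_div]
      exact pow_le_pow_left₀ (inv_nonneg.2 hL0.le) (inv_anti₀ (by norm_num) hL) i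
    exact h1.trans (h2.trans h3)
  calc |∑ i ∈ Finset.range n, g i x y| ≤ ∑ i ∈ Finset.range n, |g i x y| := Finset.abs_sum_le_sum_abs _ _
    _ ≤ ∑ i ∈ Finset.range n, C * (1 / 2 : ℝ) ^ i :=
        Finset.sum_le_sum fun i hi => hterm i (Finset.mem_range.1 hi)
    _ = C * ∑ i ∈ Finset.range n, (1 / 2 : ℝ) ^ i := by rw [Finset.mul_sum]
    _ ≤ C * 2 := mul_le_mul_of_nonneg_left (sum_geometric_two_le n) hC
    _ = 2 * C := mul_comm _ _

/-- **The double-layer row from slices** (`layer_sum_le` of `T4TwoSpacingDefect` fed by `profile_of_slices` and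
`core_of_slices`): for a face set `F` whose sup-shells about `x` have `≤ A·r^{d−2}` sites (`r ≥ 1`) within radius `N`,
per-slice bounds with `p = d − 1` give `Σ_{y∈F} |Σ_i g i x y| ≤ 2C + A·(C·K_δ)·(1 + log N)`. [folklore] -/
theorem doubleLayerRow_le {X : Type*} (g : ℕ → X → X → ℝ) (nρ : X → X → ℕ) {L δ C A : ℝ} {d N : ℕ}
    (n : ℕ) (hL : 2 ≤ L) (hδ : 0 < δ) (hC : 0 ≤ C) (hA : 0 ≤ A) (hd : 2 ≤ d)
    (hg : ∀ i < n, ∀ x y,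
      |g i x y| ≤ C * (Real.exp (-(δ * ((nρ x y : ℝ) / L ^ i))) / (L ^ i) ^ (d - 1)))
    (F : Finset X) (x : X) (hzero : ∀ y, nρ x y = 0 → y = x) (hFN : ∀ y ∈ F, nρ x y ≤ N)
    (hcard : ∀ r : ℕ, 1 ≤ r → ((F.filter fun y => nρ x y = r).card : ℝ) ≤ A * (r : ℝ) ^ (d - 2)) :
    ∑ y ∈ F, |∑ i ∈ Finset.range n, g i x y|
      ≤ 2 * C + A * (C * sliceConst δ (d - 1)) * (1 + Real.log N) := by
  have hp : 1 ≤ d - 1 := by omega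
  refine layer_sum_le F (fun y => nρ x y) (fun y => ∑ i ∈ Finset.range n, g i x y) hd hA
    (mul_nonneg hC (sliceConst_nonneg hδ _)) hFN hcard ?_ ?_
  · have hsub : F.filter (fun y => nρ x y = 0) ⊆ {x} := by
      intro y hy
      rw [Finset.mem_singleton]
      exact hzero y (Finset.mem_filter.1 hy).2
    calc ∑ y ∈ F.filter (fun y => nρ x y = 0), |∑ i ∈ Finset.range n, g i x y|
        ≤ ∑ y ∈ ({x} : Finset X), |∑ i ∈ Finset.range n, g i x y| :=
          Finset.sum_le_sum_of_subset_of_nonneg hsub (fun _ _ _ => abs_nonneg _)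
      _ = |∑ i ∈ Finset.range n, g i x x| := Finset.sum_singleton _ _
      _ ≤ 2 * C := core_of_slices g (fun u v => (nρ u v : ℝ)) n hL hδ.le hC hp
          (fun _ _ => Nat.cast_nonneg _) hg x x
  · intro y _ h1
    have h1' : (1 : ℝ) ≤ (nρ x y : ℝ) := by exact_mod_cast h1
    have h := profile_of_slices g (fun u v => (nρ u v : ℝ)) n hL hδ hC hp hg x y h1'
    simpa [mul_div_assoc] using h

/-- **Clause (T2) of `ConsistencySized` from per-level slice data (shape).**  Level `k`: lattice `X k` (the η-torus
of side `N k ≤ ℓ·L^k` sites), integer sup-distance `nρ k`, face skeleton `F k` with shells `≤ A·r^{d−2}`, slice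
kernels `g k V i`, `i < k + 1`, obeying the (3.63) shape with constants `C, δ` UNIFORM IN `i, k, V` (printed TYPE per
scale + the readings (I′)/(I″) of the module docstring — NOT asserted), and `dl k V` dominated by one double-layer row.
Then `dl k V ≤ C_DL·(1 + k log L)` with `C_DL = 2C + A·C·K_δ·(1 + log ℓ)`. [folklore] -/
theorem consistencyT2_of_slices {ι : Type*} {dom : Set ι} {X : ℕ → Type*} (F : ∀ k, Finset (X k))
    (nρ : ∀ k, X k → X k → ℕ) (g : ∀ k, ι → ℕ → X k → X k → ℝ) (N : ℕ → ℕ) (dl : ℕ → ι → ℝ)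
    {L δ C A ℓ : ℝ} {d : ℕ} (hL : 2 ≤ L) (hδ : 0 < δ) (hC : 0 ≤ C) (hA : 0 ≤ A) (hℓ : 1 ≤ ℓ) (hd : 2 ≤ d)
    (hzero : ∀ k, ∀ x y : X k, nρ k x y = 0 → y = x)
    (hFN : ∀ k, ∀ x : X k, ∀ y ∈ F k, nρ k x y ≤ N k) (hN : ∀ k, (N k : ℝ) ≤ ℓ * L ^ k)
    (hcard : ∀ k, ∀ x : X k, ∀ r : ℕ, 1 ≤ r →
      (((F k).filter fun y => nρ k x y = r).card : ℝ) ≤ A * (r : ℝ) ^ (d - 2))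
    (hg : ∀ k, ∀ V ∈ dom, ∀ i < k + 1, ∀ x y : X k,
      |g k V i x y| ≤ C * (Real.exp (-(δ * ((nρ k x y : ℝ) / L ^ i))) / (L ^ i) ^ (d - 1)))
    (hdl : ∀ k, ∀ V ∈ dom, ∃ x : X k, dl k V ≤ ∑ y ∈ F k, |∑ i ∈ Finset.range (k + 1), g k V i x y|) :
    ∀ k : ℕ, ∀ V ∈ dom,
      dl k V ≤ (2 * C + A * (C * sliceConst δ (d - 1)) * (1 + Real.log ℓ)) * (1 + k * Real.log L) := by
  intro k V hV
  obtain ⟨x, hx⟩ := hdl k V hV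
  have hrow := doubleLayerRow_le (g k V) (nρ k) (k + 1) hL hδ hC hA hd (hg k V hV) (F k) x (hzero k x)
    (hFN k x) (hcard k x)
  have hL1 : (1 : ℝ) ≤ L := by linarith
  have hℓL : (1 : ℝ) ≤ ℓ * L ^ k := one_le_mul_of_one_le_of_one_le hℓ (one_le_pow₀ hL1)
  have hlogN : Real.log (N k : ℝ) ≤ Real.log (ℓ * L ^ k) := by
    rcases Nat.eq_zero_or_pos (N k) with h0 | hpos
    · rw [h0, Nat.cast_zero, Real.log_zero]
      exact Real.log_nonneg hℓL
    · exact Real.log_le_log (by exact_mod_cast hpos) (hN k)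
  have hAC : 0 ≤ A * (C * sliceConst δ (d - 1)) := mul_nonneg hA (mul_nonneg hC (sliceConst_nonneg hδ _))
  calc dl k V ≤ ∑ y ∈ F k, |∑ i ∈ Finset.range (k + 1), g k V i x y| := hx
    _ ≤ 2 * C + A * (C * sliceConst δ (d - 1)) * (1 + Real.log (N k : ℝ)) := hrow
    _ ≤ 2 * C + A * (C * sliceConst δ (d - 1)) * (1 + Real.log (ℓ * L ^ k)) := by
        have hmono := mul_le_mul_of_nonneg_left
          (show 1 + Real.log (N k : ℝ) ≤ 1 + Real.log (ℓ * L ^ k) by linarith) hAC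
        linarith
    _ ≤ (2 * C + A * (C * sliceConst δ (d - 1)) * (1 + Real.log ℓ)) * (1 + k * Real.log L) :=
        rowConst_le (by linarith) hA (mul_nonneg hC (sliceConst_nonneg hδ _)) hℓ hL1 k

/-- **`ConsistencySized` from slice data** — the wall BY NAME, clause (T2) discharged by the telescoping, clauses (T1),
(T3), (T4), (T5) entering as hypotheses (the CONSISTENCY input (W2) is untouched by this leaf). [folklore] -/
theorem consistencySized_of_slices {ι : Type*} {dom : Set ι} {X : ℕ → Type*} (F : ∀ k, Finset (X k))
    (nρ : ∀ k, X k → X k → ℕ) (g : ∀ k, ι → ℕ → X k → X k → ℝ) (N : ℕ → ℕ)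
    {z dl sig blk lam : ℕ → ι → ℝ} {L δ C A ℓ CJ CB B : ℝ} {d : ℕ}
    (hL : 2 ≤ L) (hδ : 0 < δ) (hC : 0 ≤ C) (hA : 0 ≤ A) (hℓ : 1 ≤ ℓ) (hd : 2 ≤ d)
    (hzero : ∀ k, ∀ x y : X k, nρ k x y = 0 → y = x)
    (hFN : ∀ k, ∀ x : X k, ∀ y ∈ F k, nρ k x y ≤ N k) (hN : ∀ k, (N k : ℝ) ≤ ℓ * L ^ k)
    (hcard : ∀ k, ∀ x : X k, ∀ r : ℕ, 1 ≤ r →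
      (((F k).filter fun y => nρ k x y = r).card : ℝ) ≤ A * (r : ℝ) ^ (d - 2))
    (hg : ∀ k, ∀ V ∈ dom, ∀ i < k + 1, ∀ x y : X k,
      |g k V i x y| ≤ C * (Real.exp (-(δ * ((nρ k x y : ℝ) / L ^ i))) / (L ^ i) ^ (d - 1)))
    (hdl : ∀ k, ∀ V ∈ dom, ∃ x : X k, dl k V ≤ ∑ y ∈ F k, |∑ i ∈ Finset.range (k + 1), g k V i x y|)
    (h1 : ∀ k : ℕ, ∀ V ∈ dom, z k V ≤ dl k V * sig k V + blk k V)
    (h3 : ∀ k : ℕ, ∀ V ∈ dom, 0 ≤ sig k V ∧ sig k V ≤ CJ * lam k V)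
    (h4 : ∀ k : ℕ, ∀ V ∈ dom, 0 ≤ blk k V ∧ blk k V ≤ CB * (1 + k * Real.log L) * lam k V)
    (h5 : ∀ k : ℕ, ∀ V ∈ dom, 0 ≤ lam k V ∧ lam k V ≤ B * (L⁻¹ ^ k) ^ 3) :
    ConsistencySized dom z dl sig blk lam L (2 * C + A * (C * sliceConst δ (d - 1)) * (1 + Real.log ℓ)) CJ CB B :=
  ⟨h1, consistencyT2_of_slices F nρ g N dl hL hδ hC hA hℓ hd hzero hFN hN hcard hg hdl, h3, h4, h5⟩

/-- The double-layer constant produced by the telescoping is nonnegative (needed by the consumers). [folklore] -/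
theorem layerConst_nonneg {C A δ ℓ : ℝ} {d : ℕ} (hδ : 0 < δ) (hC : 0 ≤ C) (hA : 0 ≤ A) (hℓ : 1 ≤ ℓ) :
    0 ≤ 2 * C + A * (C * sliceConst δ (d - 1)) * (1 + Real.log ℓ) := by
  have h1 : 0 ≤ Real.log ℓ := Real.log_nonneg hℓ
  have h2 : 0 ≤ sliceConst δ (d - 1) := sliceConst_nonneg hδ _
  positivity

/-- **The node's shape BY NAME from slice data**, log-absorbed rate `θ′ = (1 + log L)/L`
(`T4TwoSpacingDefect.ne3Shape_of_consistency` ∘ `consistencySized_of_slices`). [folklore] -/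
theorem ne3Shape_of_slices {ι Xr : Type*} [Fintype Xr] {R : Readings ι Xr} {X : ℕ → Type*}
    (F : ∀ k, Finset (X k)) (nρ : ∀ k, X k → X k → ℕ) (g : ∀ k, ι → ℕ → X k → X k → ℝ) (N : ℕ → ℕ)
    {z dl sig blk lam t osc nrm pair : ℕ → ι → ℝ} {L δ C A ℓ CJ CB B CP CD B0 CR Γ Λr ρ₂ : ℝ} {d : ℕ}
    (hL : 2 ≤ L) (hδ : 0 < δ) (hC : 0 ≤ C) (hA : 0 ≤ A) (hℓ : 1 ≤ ℓ) (hd : 2 ≤ d)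
    (hzero : ∀ k, ∀ x y : X k, nρ k x y = 0 → y = x)
    (hFN : ∀ k, ∀ x : X k, ∀ y ∈ F k, nρ k x y ≤ N k) (hN : ∀ k, (N k : ℝ) ≤ ℓ * L ^ k)
    (hcard : ∀ k, ∀ x : X k, ∀ r : ℕ, 1 ≤ r →
      (((F k).filter fun y => nρ k x y = r).card : ℝ) ≤ A * (r : ℝ) ^ (d - 2))
    (hg : ∀ k, ∀ V ∈ R.dom, ∀ i < k + 1, ∀ x y : X k,
      |g k V i x y| ≤ C * (Real.exp (-(δ * ((nρ k x y : ℝ) / L ^ i))) / (L ^ i) ^ (d - 1)))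
    (hdl : ∀ k, ∀ V ∈ R.dom, ∃ x : X k, dl k V ≤ ∑ y ∈ F k, |∑ i ∈ Finset.range (k + 1), g k V i x y|)
    (h1 : ∀ k : ℕ, ∀ V ∈ R.dom, z k V ≤ dl k V * sig k V + blk k V)
    (h3 : ∀ k : ℕ, ∀ V ∈ R.dom, 0 ≤ sig k V ∧ sig k V ≤ CJ * lam k V)
    (h4 : ∀ k : ℕ, ∀ V ∈ R.dom, 0 ≤ blk k V ∧ blk k V ≤ CB * (1 + k * Real.log L) * lam k V)
    (h5 : ∀ k : ℕ, ∀ V ∈ R.dom, 0 ≤ lam k V ∧ lam k V ≤ B * (L⁻¹ ^ k) ^ 3)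
    (hCJ : 0 ≤ CJ) (hCB : 0 ≤ CB) (hCP : 0 ≤ CP) (hCD : 0 ≤ CD) (hB : 0 ≤ B) (hB0 : 0 ≤ B0) (hCR : 0 ≤ CR)
    (hΓ : 0 ≤ Γ) (hΛr : 0 ≤ Λr) (hρ₂ : 0 ≤ ρ₂)
    (ht : ∀ k : ℕ, ∀ V ∈ R.dom, t k V ≤ B0 * CR * L⁻¹ ^ k)
    (hosc : ∀ k : ℕ, ∀ V ∈ R.dom, osc k V ≤ (1 + CD) * (1 + CP) * z k V / (L⁻¹ ^ k) ^ 2 + t k V)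
    (hact : ∀ k : ℕ, ∀ V ∈ R.dom, R.act k V = ∑ x, R.loc k V x) (hvol : (Fintype.card Xr : ℝ) ≤ R.vol)
    (hread : ∀ k : ℕ, ∀ V ∈ R.dom, ∀ x : Xr,
      |R.loc (k + 1) V x - R.loc k V x| ≤ Λr * nrm k V + pair k V)
    (hresp : ∀ k : ℕ, ∀ V ∈ R.dom, nrm k V ≤ Γ * osc k V)
    (hpair : OneStepCorrectionRate R.dom pair ρ₂ ((1 + Real.log L) / L)) :
    NE3Shape R (Λr * Γ * ((1 + CD) * (1 + CP) *
      ((2 * C + A * (C * sliceConst δ (d - 1)) * (1 + Real.log ℓ)) * CJ + CB) * B + B0 * CR) + ρ₂)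
      ((1 + Real.log L) / L) :=
  ne3Shape_of_consistency
    (consistencySized_of_slices F nρ g N hL hδ hC hA hℓ hd hzero hFN hN hcard hg hdl h1 h3 h4 h5)
    hL (layerConst_nonneg hδ hC hA hℓ) hCJ hCB hCP hCD hB hB0 hCR hΓ hΛr hρ₂ ht hosc hact hvol hread hresp hpair

/-- The same at any rate `L^{−a}`, `0 < a < 1` (`T4TwoSpacingDefect.ne3Shape_of_consistency_rpow`). [folklore] -/
theorem ne3Shape_of_slices_rpow {ι Xr : Type*} [Fintype Xr] {R : Readings ι Xr} {X : ℕ → Type*}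
    (F : ∀ k, Finset (X k)) (nρ : ∀ k, X k → X k → ℕ) (g : ∀ k, ι → ℕ → X k → X k → ℝ) (N : ℕ → ℕ)
    {z dl sig blk lam t osc nrm pair : ℕ → ι → ℝ} {L δ C A ℓ CJ CB B CP CD B0 CR Γ Λr ρ₂ a : ℝ} {d : ℕ}
    (hL : 2 ≤ L) (ha0 : 0 < a) (ha : a < 1) (hδ : 0 < δ) (hC : 0 ≤ C) (hA : 0 ≤ A) (hℓ : 1 ≤ ℓ) (hd : 2 ≤ d)
    (hzero : ∀ k, ∀ x y : X k, nρ k x y = 0 → y = x)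
    (hFN : ∀ k, ∀ x : X k, ∀ y ∈ F k, nρ k x y ≤ N k) (hN : ∀ k, (N k : ℝ) ≤ ℓ * L ^ k)
    (hcard : ∀ k, ∀ x : X k, ∀ r : ℕ, 1 ≤ r →
      (((F k).filter fun y => nρ k x y = r).card : ℝ) ≤ A * (r : ℝ) ^ (d - 2))
    (hg : ∀ k, ∀ V ∈ R.dom, ∀ i < k + 1, ∀ x y : X k,
      |g k V i x y| ≤ C * (Real.exp (-(δ * ((nρ k x y : ℝ) / L ^ i))) / (L ^ i) ^ (d - 1)))
    (hdl : ∀ k, ∀ V ∈ R.dom, ∃ x : X k, dl k V ≤ ∑ y ∈ F k, |∑ i ∈ Finset.range (k + 1), g k V i x y|)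
    (h1 : ∀ k : ℕ, ∀ V ∈ R.dom, z k V ≤ dl k V * sig k V + blk k V)
    (h3 : ∀ k : ℕ, ∀ V ∈ R.dom, 0 ≤ sig k V ∧ sig k V ≤ CJ * lam k V)
    (h4 : ∀ k : ℕ, ∀ V ∈ R.dom, 0 ≤ blk k V ∧ blk k V ≤ CB * (1 + k * Real.log L) * lam k V)
    (h5 : ∀ k : ℕ, ∀ V ∈ R.dom, 0 ≤ lam k V ∧ lam k V ≤ B * (L⁻¹ ^ k) ^ 3)
    (hCJ : 0 ≤ CJ) (hCB : 0 ≤ CB) (hCP : 0 ≤ CP) (hCD : 0 ≤ CD) (hB : 0 ≤ B) (hB0 : 0 ≤ B0) (hCR : 0 ≤ CR)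
    (hΓ : 0 ≤ Γ) (hΛr : 0 ≤ Λr) (hρ₂ : 0 ≤ ρ₂)
    (ht : ∀ k : ℕ, ∀ V ∈ R.dom, t k V ≤ B0 * CR * L⁻¹ ^ k)
    (hosc : ∀ k : ℕ, ∀ V ∈ R.dom, osc k V ≤ (1 + CD) * (1 + CP) * z k V / (L⁻¹ ^ k) ^ 2 + t k V)
    (hact : ∀ k : ℕ, ∀ V ∈ R.dom, R.act k V = ∑ x, R.loc k V x) (hvol : (Fintype.card Xr : ℝ) ≤ R.vol)
    (hread : ∀ k : ℕ, ∀ V ∈ R.dom, ∀ x : Xr,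
      |R.loc (k + 1) V x - R.loc k V x| ≤ Λr * nrm k V + pair k V)
    (hresp : ∀ k : ℕ, ∀ V ∈ R.dom, nrm k V ≤ Γ * osc k V)
    (hpair : OneStepCorrectionRate R.dom pair ρ₂ (L ^ (-a))) :
    NE3Shape R (Λr * Γ * ((1 + CD) * (1 + CP) *
      ((2 * C + A * (C * sliceConst δ (d - 1)) * (1 + Real.log ℓ)) * CJ + CB) * B * (Real.exp (-a) / (1 - a))
      + B0 * CR) + ρ₂) (L ^ (-a)) :=
  ne3Shape_of_consistency_rpow
    (consistencySized_of_slices F nρ g N hL hδ hC hA hℓ hd hzero hFN hN hcard hg hdl h1 h3 h4 h5)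
    (by linarith) ha0 ha (layerConst_nonneg hδ hC hA hℓ) hCJ hCB hCP hCD hB hB0 hCR hΓ hΛr hρ₂ ht hosc hact hvol
    hread hresp hpair

end Profile

/-! ## §4  Examples (the pipeline closes on explicit data) -/
section Examples

/-- The resolvent identity for `2 × 2`-free data: numbers (a commutative sanity check of `resolvent_sub`). -/
example : ((1 : ℝ) / 3) - (1 / 2) = (1 / 2) * (2 - 3) * (1 / 3) := by norm_num

/-- `resolvent_telescope` with two scales in a general ring: `G 1 = G 0 + G 0 (K 0 − K 1) G 1`. -/
example {R : Type*} [Ring R] (K G : ℕ → R) (hl : ∀ j, G j * K j = 1) (hr : ∀ j, K j * G j = 1) :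
    G 1 = G 0 + G 0 * (K 0 - K 1) * G 1 := by
  simpa using resolvent_telescope K G hl hr 1

end Examples

end Literature.MathematicalPhysics.QuantumFieldTheory.Balaban1983to89.T4SliceTelescoping

end
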